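import Literature.NumberTheory.EllipticCurves.EisensteinSeriesTwoCharacterWeightOne
import Literature.NumberTheory.EllipticCurves.EisensteinSeriesTwoCharacterWeightTwoQExpansion
import Literature.NumberTheory.LFunctions.KloostermanPrimePower
import HarnessLib

/-!
# The `q`-expansion of the weight-`1` two-character series `S_1^{ψ,φ}`

Topic `Literature/NumberTheory/EllipticCurves`; namespace
`Literature.NumberTheory.EllipticCurves.ModularForms`.  THEOREMS and two auxiliary definitions with
bodies (`oneRow`, `twoCharOneConst`); no named fact.

For `ψ ≠ 𝟙` modulo `u`, `φ ≠ 𝟙` primitive modulo `v` with `ψ(-1)φ(-1) = -1`, the combination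
`S_1^{ψ,φ} = ∑_{c₁ mod u, d₀ mod uv} ψ(c₁) φ̄(d₀) Z_{(vc₁,d₀)}` of corrected `ζ`-division values
(`EisensteinSeriesTwoCharacterWeightOne`) has the `q`-expansion of Diamond–Shurman Thm. 4.8.1 (there
for `E_1^{ψ,φ}`, up to the normalising constant):

  `S_1^{ψ,φ}(τ) = C · ∑_{n ≥ 1} σ_0^{ψ,φ}(n) qⁿ`,  `σ_0^{ψ,φ}(n) = ∑_{d ∣ n} ψ(n/d) φ(d)`,
  `C = twoCharOneConst u φ = 2 · (-2πi) · u · τ(φ̄)`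

(`twoCharOne_eq_qExpansion`, `qExpansion_coeff_twoCharOneMF`; in particular the constant term at
`i∞` vanishes).  Proof (the printed one, op. cit. §4.8, organised as in
`EisensteinSeriesTwoCharacterWeightTwoQExpansion`): by the row decomposition
`Z_v = 2πi c_v/N + ∑_m T_m(v)`, `T_m = π cot(π w_m) + [m ≠ 0] π cot(π mτ)`
(`WeierstrassZetaDivisionValuesRows`), the level-one parts and the constants `2πi c_v/N` cancel in
the character sum (`∑_{d₀} φ̄(d₀) = 0`, `∑ ψ(c₁) φ̄(d₀) = 0`), and regrouping `(c₁, m) ↦ c = c̃₁ - um`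
gives `S = ∑_{c ∈ ℤ} ψ(c) R_c` with the rows
`R_c = ∑_{d₀ mod uv} φ̄(d₀) π cot(π (vcτ + d̃₀)/(uv))` (`oneRow`, `twoCharOne_eq_tsum_rows`).  For
`c > 0` the cotangent series `π cot(πw) = -πi - 2πi ∑_{r ≥ 1} e^{2πirw}` and the character sums
`∑_{d₀ mod uv} φ̄(d₀) e(r d₀/(uv)) = [u ∣ r] · u φ(r/u) τ(φ̄)` (`sum_inv_castHom_mul_stdAddChar_of_dvd`,
`…_of_not_dvd`) give `R_c = -2πi u τ(φ̄) ∑_{n ≥ 1} φ(n) q^{cn}` (`hasSum_oneRow_of_pos`); the rows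
`c < 0` are computed the same way (`hasSum_oneRow_neg_of_pos`) and contribute equally because
`ψ(-1)φ(-1) = -1`; the row `c = 0` carries the weight `ψ(0) = 0`.  The double series is then
resummed by divisors (`tsum_prod_weight₂_mul_pow_eq_tsum_divisorSum`).

## References

* F. Diamond, J. Shurman, *A First Course in Modular Forms*, GTM 228 (2005), §4.8 (Thm. 4.8.1).
  [DiamondShurman2005]
* E. Hecke, *Theorie der Eisensteinschen Reihen höherer Stufe und ihre Anwendung auf
  Funktionentheorie und Arithmetik*, Abh. Math. Sem. Hamburg 5 (1927), §2. [Hecke1927]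
-/

noncomputable section

open UpperHalfPlane hiding I
open EisensteinSeries ModularForm Complex Filter Finset Function

open scoped Real MatrixGroups

namespace Literature.NumberTheory.EllipticCurves.ModularForms

/-! ### Character sums over `ℤ/uv` -/

section CharSums

variable {u v : ℕ} [NeZero u] [NeZero v] (φ : DirichletCharacter ℂ v)

omit [NeZero v] in
/-- `∑_{d₀ mod uv} G(d₀ mod v) = u ∑_{a mod v} G(a)`. [folklore] -/
theorem sum_castHom_eq_mul_sum [NeZero v] (G : ZMod v → ℂ) :
    ∑ d₀ : ZMod (u * v), G (ZMod.castHom (dvd_mul_left v u) (ZMod v) d₀) = u * ∑ a : ZMod v, G a := by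
  haveI : NeZero (u * v) := ⟨mul_ne_zero (NeZero.ne u) (NeZero.ne v)⟩
  have h1 : ∑ d₀ : ZMod (u * v), G (ZMod.castHom (dvd_mul_left v u) (ZMod v) d₀) =
      ∑ n ∈ range (u * v), G (n : ZMod v) := by
    rw [Literature.NumberTheory.LFunctions.sum_zmod_eq_sum_range]
    refine Finset.sum_congr rfl fun n _ ↦ ?_
    rw [map_natCast]
  rw [h1, Literature.NumberTheory.LFunctions.sum_zmod_eq_sum_range G, mul_comm u v,
    Literature.NumberTheory.LFunctions.sum_range_mul_eq_sum_sum]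
  have h2 : ∀ a ∈ range v, ∑ b ∈ range u, G ((a + v * b : ℕ) : ZMod v) = u * G (a : ZMod v) := by
    intro a _
    have : ∀ b ∈ range u, G ((a + v * b : ℕ) : ZMod v) = G (a : ZMod v) := fun b _ ↦ by
      congr 1
      push_cast
      rw [ZMod.natCast_self, zero_mul, add_zero]
    rw [Finset.sum_congr rfl this, Finset.sum_const, Finset.card_range, nsmul_eq_mul]
  rw [Finset.sum_congr rfl h2, Finset.mul_sum]

/-- `∑_{d₀ mod uv} φ̄(d₀) = 0` for `φ ≠ 𝟙`. [folklore] -/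
theorem sum_inv_castHom_eq_zero (hφ1 : φ ≠ 1) :
    ∑ d₀ : ZMod (u * v), φ⁻¹ (ZMod.castHom (dvd_mul_left v u) (ZMod v) d₀) = 0 := by
  rw [sum_castHom_eq_mul_sum (u := u) (fun a ↦ φ⁻¹ a),
    MulChar.sum_eq_zero_of_ne_one (by rwa [Ne, inv_eq_one]), mul_zero]

omit [NeZero v] in
/-- The reduction `ℤ/uv → ℤ/v` through representatives. [folklore] -/
theorem castHom_right_eq_intCast_val [NeZero v] (d₀ : ZMod (u * v)) :
    ZMod.castHom (dvd_mul_left v u) (ZMod v) d₀ = ((d₀.val : ℤ) : ZMod v) := by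
  haveI : NeZero (u * v) := ⟨mul_ne_zero (NeZero.ne u) (NeZero.ne v)⟩
  conv_lhs => rw [← ZMod.natCast_zmod_val d₀]
  rw [map_natCast, Int.cast_natCast]

omit [NeZero v] in
/-- `e_{uv}(u n d₀) = e_v(n (d₀ mod v))`: `exp(2πi (u n d̃₀)/(uv)) = exp(2πi n d̃₀/v)`. [folklore] -/
theorem stdAddChar_mul_eq_of_dvd [NeZero v] (n : ℤ) (d₀ : ZMod (u * v)) :
    (ZMod.stdAddChar ((((u : ℤ) * n : ℤ) : ZMod (u * v)) * d₀) : ℂ) =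
      ZMod.stdAddChar ((n : ZMod v) * ZMod.castHom (dvd_mul_left v u) (ZMod v) d₀) := by
  haveI : NeZero (u * v) := ⟨mul_ne_zero (NeZero.ne u) (NeZero.ne v)⟩
  have hu0 : (u : ℂ) ≠ 0 := by exact_mod_cast NeZero.ne u
  have hv0 : (v : ℂ) ≠ 0 := by exact_mod_cast NeZero.ne v
  have hd : (((u : ℤ) * n : ℤ) : ZMod (u * v)) * d₀ =
      (((u : ℤ) * n * (d₀.val : ℤ) : ℤ) : ZMod (u * v)) := by
    conv_lhs => rw [← ZMod.natCast_zmod_val d₀]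
    push_cast
    ring
  have hd' : (n : ZMod v) * ZMod.castHom (dvd_mul_left v u) (ZMod v) d₀ =
      ((n * (d₀.val : ℤ) : ℤ) : ZMod v) := by
    rw [castHom_right_eq_intCast_val]
    push_cast
    ring
  rw [hd, hd', ZMod.stdAddChar_coe, ZMod.stdAddChar_coe]
  congr 1
  push_cast
  field_simp

/-- **`∑_{d₀ mod uv} φ̄(d₀) e(u n d₀/(uv)) = u φ(n) τ(φ̄)`** (`φ` primitive; a Gauss sum of `φ̄`
repeated `u` times). [cite: DiamondShurman2005, §4.8] -/
theorem sum_inv_castHom_mul_stdAddChar_of_dvd (hφ : φ.IsPrimitive) (n : ℤ) :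
    ∑ d₀ : ZMod (u * v), φ⁻¹ (ZMod.castHom (dvd_mul_left v u) (ZMod v) d₀) *
        ZMod.stdAddChar ((((u : ℤ) * n : ℤ) : ZMod (u * v)) * d₀) =
      u * (φ (n : ZMod v) * gaussSum φ⁻¹ (ZMod.stdAddChar (N := v))) := by
  have hφ' := Literature.NumberTheory.LFunctions.isPrimitive_inv φ hφ
  have key : ∀ d₀ : ZMod (u * v), φ⁻¹ (ZMod.castHom (dvd_mul_left v u) (ZMod v) d₀) *
      ZMod.stdAddChar ((((u : ℤ) * n : ℤ) : ZMod (u * v)) * d₀) =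
      (fun a : ZMod v ↦ φ⁻¹ a * ZMod.stdAddChar ((n : ZMod v) * a))
        (ZMod.castHom (dvd_mul_left v u) (ZMod v) d₀) := by
    intro d₀
    simp only
    rw [stdAddChar_mul_eq_of_dvd]
  rw [Finset.sum_congr rfl fun d₀ _ ↦ key d₀,
    sum_castHom_eq_mul_sum (u := u) (fun a : ZMod v ↦ φ⁻¹ a * ZMod.stdAddChar ((n : ZMod v) * a))]
  congr 1
  have hg := gaussSum_mulShift_of_isPrimitive (ZMod.stdAddChar (N := v)) hφ' (n : ZMod v)
  rw [inv_inv] at hg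
  rw [← hg, gaussSum]
  refine Finset.sum_congr rfl fun a _ ↦ ?_
  rw [AddChar.mulShift_apply]

/-- **`∑_{d₀ mod uv} φ̄(d₀) e(r d₀/(uv)) = 0` for `u ∤ r`** (the sum is invariant under `d₀ ↦ d₀ + v`,
which multiplies it by `e(r/u) ≠ 1`). [cite: DiamondShurman2005, §4.8] -/
theorem sum_inv_castHom_mul_stdAddChar_of_not_dvd {r : ℤ} (hr : ¬ (u : ℤ) ∣ r) :
    ∑ d₀ : ZMod (u * v), φ⁻¹ (ZMod.castHom (dvd_mul_left v u) (ZMod v) d₀) *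
        ZMod.stdAddChar ((r : ZMod (u * v)) * d₀) = 0 := by
  haveI : NeZero (u * v) := ⟨mul_ne_zero (NeZero.ne u) (NeZero.ne v)⟩
  set F : ZMod (u * v) → ℂ := fun d₀ ↦ φ⁻¹ (ZMod.castHom (dvd_mul_left v u) (ZMod v) d₀) *
    ZMod.stdAddChar ((r : ZMod (u * v)) * d₀) with hF
  set e : ℂ := ZMod.stdAddChar ((r : ZMod (u * v)) * (v : ZMod (u * v))) with he
  change ∑ d₀ : ZMod (u * v), F d₀ = 0
  have h1 : ∑ d₀ : ZMod (u * v), F (d₀ + v) = ∑ d₀ : ZMod (u * v), F d₀ :=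
    Fintype.sum_equiv (Equiv.addRight (v : ZMod (u * v))) _ _ fun _ ↦ rfl
  have h2 : ∀ d₀ : ZMod (u * v), F (d₀ + v) = e * F d₀ := by
    intro d₀
    simp only [hF, he]
    rw [map_add, map_natCast, ZMod.natCast_self, add_zero, mul_add, AddChar.map_add_eq_mul]
    ring
  have hshift : ∑ d₀ : ZMod (u * v), F d₀ = e * ∑ d₀ : ZMod (u * v), F d₀ :=
    calc ∑ d₀ : ZMod (u * v), F d₀ = ∑ d₀ : ZMod (u * v), F (d₀ + v) := h1.symm
      _ = ∑ d₀ : ZMod (u * v), e * F d₀ := Finset.sum_congr rfl fun d₀ _ ↦ h2 d₀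
      _ = e * ∑ d₀ : ZMod (u * v), F d₀ := (Finset.mul_sum _ _ _).symm
  have hne : e ≠ 1 := by
    intro h
    have h0 : (r : ZMod (u * v)) * (v : ZMod (u * v)) = 0 :=
      ZMod.injective_stdAddChar (N := u * v) (by rw [← he, h, AddChar.map_zero_eq_one])
    have hdvd : ((u * v : ℕ) : ℤ) ∣ r * v := by
      rw [← ZMod.intCast_zmod_eq_zero_iff_dvd]
      push_cast
      exact h0
    apply hr
    have hv0 : (v : ℤ) ≠ 0 := by exact_mod_cast NeZero.ne v
    rw [Nat.cast_mul] at hdvd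
    exact (mul_dvd_mul_iff_right hv0).mp hdvd
  have h3 : (1 - e) * ∑ d₀ : ZMod (u * v), F d₀ = 0 := by linear_combination hshift
  exact (mul_eq_zero.mp h3).resolve_left (sub_ne_zero.mpr (Ne.symm hne))

end CharSums

/-! ### The rows `R_c` -/

section Rows

variable {v : ℕ} [NeZero v]

/-- **The row `R_c(τ) = ∑_{d₀ mod uv} φ̄(d₀) π cot(π (vcτ + d̃₀)/(uv))`** of the character
combination of the `ζ`-division rows. [cite: DiamondShurman2005, §4.8] -/
def oneRow (u : ℕ) [NeZero u] (φ : DirichletCharacter ℂ v) (c : ℤ) (τ : ℍ) : ℂ :=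
  ∑ d₀ : ZMod (u * v), φ⁻¹ (ZMod.castHom (dvd_mul_left v u) (ZMod v) d₀) *
    (π * Complex.cot (π * divPoint (u * v) ![(v : ℤ) * c, (d₀.val : ℤ)] τ))

variable (φ : DirichletCharacter ℂ v)

/-- `q_{N}^{N n} = qⁿ` for the parameter `q_N = e^{2πiτ/N}`. [folklore] -/
theorem qParam_pow_mul (N : ℕ) (hN : N ≠ 0) (τ : ℍ) (n : ℕ) :
    Periodic.qParam N τ ^ (N * n) = cexp (2 * π * I * τ) ^ n := by
  rw [pow_mul]
  congr 1
  rw [Periodic.qParam, ← Complex.exp_nat_mul]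
  congr 1
  have : (N : ℂ) ≠ 0 := by exact_mod_cast hN
  push_cast
  field_simp

/-- **The rows `c > 0`**: `R_c = -2πi u τ(φ̄) ∑_{n ≥ 1} φ(n) q^{cn}` (`φ ≠ 𝟙` primitive).
[cite: DiamondShurman2005, §4.8 (Thm. 4.8.1)] -/
theorem hasSum_oneRow_of_pos (u : ℕ) [NeZero u] (hφ : φ.IsPrimitive) (hφ1 : φ ≠ 1) {c : ℕ} (hc : 0 < c) (τ : ℍ) :
    HasSum (fun n : ℕ ↦ (-(2 * π * I) * u * gaussSum φ⁻¹ (ZMod.stdAddChar (N := v))) * φ n *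
        cexp (2 * π * I * c * τ) ^ n) (oneRow u φ c τ) := by
  haveI : NeZero (u * v) := ⟨mul_ne_zero (NeZero.ne u) (NeZero.ne v)⟩
  have hN : 0 < u * v := Nat.pos_of_ne_zero (NeZero.ne (u * v))
  have hu0 : (u : ℂ) ≠ 0 := by exact_mod_cast NeZero.ne u
  -- the points `w_{d₀} = (vcτ + d̃₀)/(uv) ∈ ℍ` and their exponentials
  have hw : ∀ d₀ : ZMod (u * v), divPoint (u * v) ![(v : ℤ) * c, (d₀.val : ℤ)] τ =
      (((v * c : ℕ) : ℂ) * τ + ((d₀.val : ℤ) : ℂ)) / (u * v : ℕ) := by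
    intro d₀
    unfold divPoint
    simp only [Matrix.cons_val_zero, Matrix.cons_val_one, Matrix.cons_val_fin_one]
    push_cast
    ring
  have hwpos : ∀ d₀ : ZMod (u * v),
      0 < ((((v * c : ℕ) : ℂ) * τ + ((d₀.val : ℤ) : ℂ)) / (u * v : ℕ)).im := by
    intro d₀
    have := im_div_pos (N := u * v) (show (0 : ℤ) < ((v * c : ℕ) : ℤ) by
      exact_mod_cast Nat.mul_pos (NeZero.pos v) hc) (d₀.val : ℤ) τ hN
    simpa using this
  -- per `d₀`: the cotangent series
  have hd : ∀ d₀ : ZMod (u * v), HasSum (fun r : ℕ ↦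
      φ⁻¹ (ZMod.castHom (dvd_mul_left v u) (ZMod v) d₀) *
        (if r = 0 then 0 else -(2 * π * I) *
          (cexp (2 * π * I * ((r * (d₀.val : ℤ) : ℤ) : ℂ) / (u * v : ℕ)) *
            Periodic.qParam (u * v : ℕ) τ ^ (r * (v * c)))))
      (φ⁻¹ (ZMod.castHom (dvd_mul_left v u) (ZMod v) d₀) *
        (π * Complex.cot (π * divPoint (u * v) ![(v : ℤ) * c, (d₀.val : ℤ)] τ) + π * I)) := by
    intro d₀
    rw [hw d₀]
    refine ((hasSum_cot_of_im_pos (hwpos d₀)).mul_left _).congr_fun fun r ↦ ?_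
    by_cases hr : r = 0
    · simp [hr]
    · rw [if_neg hr, if_neg hr, cexp_two_pi_I_linear_div_pow]
  -- sum over `d₀`
  have hsum := hasSum_sum fun d₀ (_ : d₀ ∈ (Finset.univ : Finset (ZMod (u * v)))) ↦ hd d₀
  have hval : ∑ d₀ : ZMod (u * v), φ⁻¹ (ZMod.castHom (dvd_mul_left v u) (ZMod v) d₀) *
      (π * Complex.cot (π * divPoint (u * v) ![(v : ℤ) * c, (d₀.val : ℤ)] τ) + π * I) =
      oneRow u φ c τ := by
    simp_rw [mul_add]
    rw [Finset.sum_add_distrib, ← Finset.sum_mul, sum_inv_castHom_eq_zero φ hφ1, zero_mul,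
      add_zero]
    rfl
  rw [hval] at hsum
  -- the `d₀`-sums of the terms: `[r ≠ 0] (-2πi) q_{uv}^{rvc} T(r)`
  have hterm : ∀ r : ℕ, ∑ d₀ : ZMod (u * v), φ⁻¹ (ZMod.castHom (dvd_mul_left v u) (ZMod v) d₀) *
      (if r = 0 then 0 else -(2 * π * I) *
        (cexp (2 * π * I * ((r * (d₀.val : ℤ) : ℤ) : ℂ) / (u * v : ℕ)) *
          Periodic.qParam (u * v : ℕ) τ ^ (r * (v * c)))) =
      if r = 0 then 0 else -(2 * π * I) * Periodic.qParam (u * v : ℕ) τ ^ (r * (v * c)) *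
        ∑ d₀ : ZMod (u * v), φ⁻¹ (ZMod.castHom (dvd_mul_left v u) (ZMod v) d₀) *
          ZMod.stdAddChar (((r : ℤ) : ZMod (u * v)) * d₀) := by
    intro r
    split_ifs with hr
    · simp
    · rw [Finset.mul_sum]
      refine Finset.sum_congr rfl fun d₀ _ ↦ ?_
      have : (((r : ℤ) : ZMod (u * v)) * d₀) = (((r * (d₀.val : ℤ) : ℤ)) : ZMod (u * v)) := by
        conv_lhs => rw [← ZMod.natCast_zmod_val d₀]
        push_cast
        ring
      rw [this, ZMod.stdAddChar_coe]
      ring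
  simp_rw [hterm] at hsum
  -- only the multiples `r = un` survive
  have hsupp : ∀ r : ℕ, r ∉ Set.range (fun n : ℕ ↦ u * n) →
      (if r = 0 then 0 else -(2 * π * I) * Periodic.qParam (u * v : ℕ) τ ^ (r * (v * c)) *
        ∑ d₀ : ZMod (u * v), φ⁻¹ (ZMod.castHom (dvd_mul_left v u) (ZMod v) d₀) *
          ZMod.stdAddChar (((r : ℤ) : ZMod (u * v)) * d₀)) = 0 := by
    intro r hr
    have hur : ¬ (u : ℤ) ∣ (r : ℤ) := by
      rintro ⟨k, hk⟩
      apply hr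
      refine ⟨k.toNat, ?_⟩
      have hk0 : 0 ≤ k := by
        by_contra hneg
        push Not at hneg
        have : (u : ℤ) * k ≤ 0 := mul_nonpos_of_nonneg_of_nonpos (by positivity) hneg.le
        have hr0 : (r : ℤ) ≤ 0 := hk ▸ this
        have : r = 0 := by omega
        subst this
        exact hr ⟨0, by simp⟩
      have : (u : ℤ) * (k.toNat : ℤ) = r := by rw [Int.toNat_of_nonneg hk0, ← hk]
      exact_mod_cast this
    rw [sum_inv_castHom_mul_stdAddChar_of_not_dvd φ hur]
    simp
  have h2 := (Function.Injective.hasSum_iff (mul_right_injective₀ (NeZero.ne u)) hsupp).mpr hsum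
  refine h2.congr_fun fun n ↦ ?_
  simp only [Function.comp_apply]
  by_cases hn : n = 0
  · subst hn
    simp [apply_zero_eq_zero_of_ne_one φ hφ1]
  · rw [if_neg (mul_ne_zero (NeZero.ne u) hn),
      show (((u * n : ℕ) : ℤ) : ZMod (u * v)) = ((((u : ℤ) * (n : ℤ) : ℤ)) : ZMod (u * v)) by
        push_cast; ring,
      sum_inv_castHom_mul_stdAddChar_of_dvd φ hφ (n : ℤ), Int.cast_natCast]
    have hq : Periodic.qParam (u * v : ℕ) τ ^ (u * n * (v * c)) = cexp (2 * π * I * c * τ) ^ n := by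
      rw [show u * n * (v * c) = (u * v) * (c * n) by ring, qParam_pow_mul (u * v) (NeZero.ne _) τ,
        pow_mul, ← Complex.exp_nat_mul]
      congr 1
      congr 1
      ring
    rw [hq]
    ring

/-- **The rows `c < 0`**: `R_{-c} = 2πi u τ(φ̄) φ(-1) ∑_{n ≥ 1} φ(n) q^{cn}` for `c > 0`
(`φ ≠ 𝟙` primitive). [cite: DiamondShurman2005, §4.8 (Thm. 4.8.1)] -/
theorem hasSum_oneRow_neg_of_pos (u : ℕ) [NeZero u] (hφ : φ.IsPrimitive) (hφ1 : φ ≠ 1) {c : ℕ} (hc : 0 < c)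
    (τ : ℍ) :
    HasSum (fun n : ℕ ↦ ((2 * π * I) * u * gaussSum φ⁻¹ (ZMod.stdAddChar (N := v)) * φ (-1)) *
        φ n * cexp (2 * π * I * c * τ) ^ n) (oneRow u φ (-(c : ℤ)) τ) := by
  haveI : NeZero (u * v) := ⟨mul_ne_zero (NeZero.ne u) (NeZero.ne v)⟩
  have hN : 0 < u * v := Nat.pos_of_ne_zero (NeZero.ne (u * v))
  have hu0 : (u : ℂ) ≠ 0 := by exact_mod_cast NeZero.ne u
  -- `w_{d₀} = -w'` with `w' = (vcτ - d̃₀)/(uv) ∈ ℍ`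
  have hw : ∀ d₀ : ZMod (u * v), divPoint (u * v) ![(v : ℤ) * (-(c : ℤ)), (d₀.val : ℤ)] τ =
      -((((v * c : ℕ) : ℂ) * τ + ((-(d₀.val : ℤ) : ℤ) : ℂ)) / (u * v : ℕ)) := by
    intro d₀
    unfold divPoint
    simp only [Matrix.cons_val_zero, Matrix.cons_val_one, Matrix.cons_val_fin_one]
    push_cast
    ring
  have hwpos : ∀ d₀ : ZMod (u * v),
      0 < ((((v * c : ℕ) : ℂ) * τ + ((-(d₀.val : ℤ) : ℤ) : ℂ)) / (u * v : ℕ)).im := by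
    intro d₀
    have := im_div_pos (N := u * v) (show (0 : ℤ) < ((v * c : ℕ) : ℤ) by
      exact_mod_cast Nat.mul_pos (NeZero.pos v) hc) (-(d₀.val : ℤ)) τ hN
    simpa using this
  have hwneg : ∀ d₀ : ZMod (u * v),
      (-((((v * c : ℕ) : ℂ) * τ + ((-(d₀.val : ℤ) : ℤ) : ℂ)) / (u * v : ℕ))).im < 0 := by
    intro d₀
    rw [neg_im, neg_lt_zero]
    exact hwpos d₀
  have hd : ∀ d₀ : ZMod (u * v), HasSum (fun r : ℕ ↦
      φ⁻¹ (ZMod.castHom (dvd_mul_left v u) (ZMod v) d₀) *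
        (if r = 0 then 0 else (2 * π * I) *
          (cexp (2 * π * I * ((r * (-(d₀.val : ℤ)) : ℤ) : ℂ) / (u * v : ℕ)) *
            Periodic.qParam (u * v : ℕ) τ ^ (r * (v * c)))))
      (φ⁻¹ (ZMod.castHom (dvd_mul_left v u) (ZMod v) d₀) *
        (π * Complex.cot (π * divPoint (u * v) ![(v : ℤ) * (-(c : ℤ)), (d₀.val : ℤ)] τ) -
          π * I)) := by
    intro d₀
    rw [hw d₀]
    have hs := hasSum_cot_of_im_neg (hwneg d₀)
    rw [neg_neg] at hs
    refine (hs.mul_left _).congr_fun fun r ↦ ?_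
    by_cases hr : r = 0
    · simp [hr]
    · rw [if_neg hr, if_neg hr, cexp_two_pi_I_linear_div_pow]
  have hsum := hasSum_sum fun d₀ (_ : d₀ ∈ (Finset.univ : Finset (ZMod (u * v)))) ↦ hd d₀
  have hval : ∑ d₀ : ZMod (u * v), φ⁻¹ (ZMod.castHom (dvd_mul_left v u) (ZMod v) d₀) *
      (π * Complex.cot (π * divPoint (u * v) ![(v : ℤ) * (-(c : ℤ)), (d₀.val : ℤ)] τ) - π * I) =
      oneRow u φ (-(c : ℤ)) τ := by
    simp_rw [mul_sub]
    rw [Finset.sum_sub_distrib, ← Finset.sum_mul, sum_inv_castHom_eq_zero φ hφ1, zero_mul,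
      sub_zero]
    rfl
  rw [hval] at hsum
  have hterm : ∀ r : ℕ, ∑ d₀ : ZMod (u * v), φ⁻¹ (ZMod.castHom (dvd_mul_left v u) (ZMod v) d₀) *
      (if r = 0 then 0 else (2 * π * I) *
        (cexp (2 * π * I * ((r * (-(d₀.val : ℤ)) : ℤ) : ℂ) / (u * v : ℕ)) *
          Periodic.qParam (u * v : ℕ) τ ^ (r * (v * c)))) =
      if r = 0 then 0 else (2 * π * I) * Periodic.qParam (u * v : ℕ) τ ^ (r * (v * c)) *
        ∑ d₀ : ZMod (u * v), φ⁻¹ (ZMod.castHom (dvd_mul_left v u) (ZMod v) d₀) *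
          ZMod.stdAddChar (((-(r : ℤ) : ℤ) : ZMod (u * v)) * d₀) := by
    intro r
    split_ifs with hr
    · simp
    · rw [Finset.mul_sum]
      refine Finset.sum_congr rfl fun d₀ _ ↦ ?_
      have : (((-(r : ℤ) : ℤ) : ZMod (u * v)) * d₀) =
          (((r * (-(d₀.val : ℤ)) : ℤ)) : ZMod (u * v)) := by
        conv_lhs => rw [← ZMod.natCast_zmod_val d₀]
        push_cast
        ring
      rw [this, ZMod.stdAddChar_coe]
      ring
  simp_rw [hterm] at hsum
  have hsupp : ∀ r : ℕ, r ∉ Set.range (fun n : ℕ ↦ u * n) →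
      (if r = 0 then 0 else (2 * π * I) * Periodic.qParam (u * v : ℕ) τ ^ (r * (v * c)) *
        ∑ d₀ : ZMod (u * v), φ⁻¹ (ZMod.castHom (dvd_mul_left v u) (ZMod v) d₀) *
          ZMod.stdAddChar (((-(r : ℤ) : ℤ) : ZMod (u * v)) * d₀)) = 0 := by
    intro r hr
    have hur : ¬ (u : ℤ) ∣ (-(r : ℤ)) := by
      rw [dvd_neg]
      rintro ⟨k, hk⟩
      apply hr
      refine ⟨k.toNat, ?_⟩
      have hk0 : 0 ≤ k := by
        by_contra hneg
        push Not at hneg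
        have : (u : ℤ) * k ≤ 0 := mul_nonpos_of_nonneg_of_nonpos (by positivity) hneg.le
        have hr0 : (r : ℤ) ≤ 0 := hk ▸ this
        have : r = 0 := by omega
        subst this
        exact hr ⟨0, by simp⟩
      have : (u : ℤ) * (k.toNat : ℤ) = r := by rw [Int.toNat_of_nonneg hk0, ← hk]
      exact_mod_cast this
    rw [sum_inv_castHom_mul_stdAddChar_of_not_dvd φ hur]
    simp
  have h2 := (Function.Injective.hasSum_iff (mul_right_injective₀ (NeZero.ne u)) hsupp).mpr hsum
  refine h2.congr_fun fun n ↦ ?_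
  simp only [Function.comp_apply]
  by_cases hn : n = 0
  · subst hn
    simp [apply_zero_eq_zero_of_ne_one φ hφ1]
  · rw [if_neg (mul_ne_zero (NeZero.ne u) hn),
      show ((-((u * n : ℕ) : ℤ) : ℤ) : ZMod (u * v)) = ((((u : ℤ) * (-(n : ℤ)) : ℤ)) : ZMod (u * v)) by
        push_cast; ring,
      sum_inv_castHom_mul_stdAddChar_of_dvd φ hφ (-(n : ℤ)), Int.cast_neg, Int.cast_natCast]
    have hq : Periodic.qParam (u * v : ℕ) τ ^ (u * n * (v * c)) = cexp (2 * π * I * c * τ) ^ n := by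
      rw [show u * n * (v * c) = (u * v) * (c * n) by ring, qParam_pow_mul (u * v) (NeZero.ne _) τ,
        pow_mul, ← Complex.exp_nat_mul]
      congr 1
      congr 1
      ring
    have hφn : φ (-(n : ZMod v)) = φ (-1) * φ n := by
      rw [neg_eq_neg_one_mul, map_mul]
    rw [hq, hφn]
    ring

end Rows

/-! ### Regrouping `S_1^{ψ,φ}` by rows -/

section Regroup

variable {u v : ℕ} [NeZero u] [NeZero v] (ψ : DirichletCharacter ℂ u) (φ : DirichletCharacter ℂ v)
  (τ : ℍ)

/-- `Z_{(vc₁,d₀)} = eisensteinOneDiv (uv) (v c̃₁, d̃₀)`. [folklore] -/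
theorem eisensteinOneDivZ_tcVec (c₁ : ZMod u) (d₀ : ZMod (u * v)) :
    eisensteinOneDivZ (u * v) (tcVec c₁ d₀) = eisensteinOneDiv (u * v) (tcLift c₁ d₀) := by
  refine eisensteinOneDivZ_eq_of_intCast (u * v) _ _ fun i ↦ ?_
  fin_cases i
  · simp [tcLift, tcVec, vMul]
  · simp [tcLift, tcVec]

/-- **The character sum over `d₀` of the rows `T_m` of the `Z_{(vc₁,d₀)}`**:
`∑_{d₀} ψ(c₁) φ̄(d₀) T_m(vc̃₁, d̃₀) = ψ(c₁) R_{c̃₁ - um}` (the level-one part `[m ≠ 0] π cot(π mτ)`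
cancels as `∑ φ̄(d₀) = 0`; the term `(c₁, d₀) = (0, 0)` has weight `ψ(0) = 0`).
[cite: DiamondShurman2005, §4.8] -/
theorem sum_tcWeight_mul_zetaRow (hψ1 : ψ ≠ 1) (hφ1 : φ ≠ 1) (c₁ : ZMod u) (m : ℤ) :
    ∑ d₀ : ZMod (u * v), tcWeight ψ φ c₁ d₀ * zetaRow (u * v) (tcLift c₁ d₀) τ m =
      ψ c₁ * oneRow u φ ((c₁.val : ℤ) - u * m) τ := by
  haveI : NeZero (u * v) := ⟨mul_ne_zero (NeZero.ne u) (NeZero.ne v)⟩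
  have hrow : ∀ d₀ : ZMod (u * v), tcWeight ψ φ c₁ d₀ * zetaRow (u * v) (tcLift c₁ d₀) τ m =
      tcWeight ψ φ c₁ d₀ *
        (π * Complex.cot (π * divPoint (u * v) ![(v : ℤ) * ((c₁.val : ℤ) - u * m), (d₀.val : ℤ)] τ) +
          (if m = 0 then 0 else π * Complex.cot (π * ((m : ℂ) * τ)))) := by
    intro d₀
    by_cases hv : ((u * v : ℕ) : ℤ) ∣ tcLift c₁ d₀ 0 ∧ ((u * v : ℕ) : ℤ) ∣ tcLift c₁ d₀ 1
    · -- then `c₁ = 0` and the weight vanishes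
      have hc₁ : c₁ = 0 := by
        have h0 := hv.1
        simp only [tcLift, Matrix.cons_val_zero] at h0
        have h1 : u * v ∣ v * c₁.val := by exact_mod_cast h0
        have h2 : u ∣ c₁.val := by
          rw [mul_comm u v] at h1
          exact (Nat.mul_dvd_mul_iff_left (NeZero.pos v)).mp h1
        exact (ZMod.val_eq_zero c₁).mp (Nat.eq_zero_of_dvd_of_lt h2 (ZMod.val_lt c₁))
      rw [hc₁, tcWeight, apply_zero_eq_zero_of_ne_one ψ hψ1, zero_mul, zero_mul, zero_mul]
    · have hvec : (![tcLift c₁ d₀ 0 - ((u * v : ℕ) : ℤ) * m, tcLift c₁ d₀ 1] : Fin 2 → ℤ) =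
          ![(v : ℤ) * ((c₁.val : ℤ) - u * m), (d₀.val : ℤ)] := by
        ext i
        fin_cases i
        · simp [tcLift]
          ring
        · simp [tcLift]
      rw [zetaRow_eq_cot _ τ m hv, hvec]
  rw [Finset.sum_congr rfl fun d₀ _ ↦ hrow d₀]
  simp_rw [mul_add]
  rw [Finset.sum_add_distrib, ← Finset.sum_mul]
  have hw0 : ∑ d₀ : ZMod (u * v), tcWeight ψ φ c₁ d₀ = 0 := by
    simp only [tcWeight, ← Finset.mul_sum, sum_inv_castHom_eq_zero φ hφ1, mul_zero]
  rw [hw0, zero_mul, add_zero, oneRow, Finset.mul_sum]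
  refine Finset.sum_congr rfl fun d₀ _ ↦ ?_
  rw [tcWeight]
  ring

/-- **`S_1^{ψ,φ}(τ) = ∑_{c ∈ ℤ} ψ(c) R_c(τ)`** (`ψ ≠ 𝟙`, `φ ≠ 𝟙`), granted the summability of the
weighted rows (supplied below from their `q`-expansions): the constants `2πi vc̃₁/(uv)` and the
level-one rows cancel, and `(c₁, m) ↦ c = c̃₁ - um` is a bijection onto `ℤ`.
[cite: DiamondShurman2005, §4.8] -/
theorem twoCharOne_eq_tsum_rows (hψ1 : ψ ≠ 1) (hφ1 : φ ≠ 1)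
    (hF : Summable fun c : ℤ ↦ ψ c * oneRow u φ c τ) :
    twoCharOne ψ φ τ = ∑' c : ℤ, ψ c * oneRow u φ c τ := by
  haveI : NeZero (u * v) := ⟨mul_ne_zero (NeZero.ne u) (NeZero.ne v)⟩
  -- `Z_{(vc₁,d₀)} = 2πi v c̃₁/(uv) + Σ_m T_m`
  have hZ : ∀ (c₁ : ZMod u) (d₀ : ZMod (u * v)), eisensteinOneDivZ (u * v) (tcVec c₁ d₀) τ =
      2 * π * I * ((v * c₁.val : ℕ) : ℂ) / (u * v : ℕ) +
        ∑' m : ℤ, zetaRow (u * v) (tcLift c₁ d₀) τ m := by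
    intro c₁ d₀
    rw [eisensteinOneDivZ_tcVec,
      (hasSum_zetaRow_eisensteinOneDiv (N := u * v) (tcLift c₁ d₀) τ).tsum_eq]
    simp only [tcLift, Matrix.cons_val_zero, Int.cast_natCast]
    ring
  have hT : ∀ (c₁ : ZMod u) (d₀ : ZMod (u * v)),
      Summable fun m : ℤ ↦ tcWeight ψ φ c₁ d₀ * zetaRow (u * v) (tcLift c₁ d₀) τ m :=
    fun c₁ d₀ ↦ (summable_zetaRow (N := u * v) (tcLift c₁ d₀) τ).mul_left _
  have hconst : ∑ c₁ : ZMod u, ∑ d₀ : ZMod (u * v), tcWeight ψ φ c₁ d₀ *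
      (2 * π * I * ((v * c₁.val : ℕ) : ℂ) / (u * v : ℕ)) = 0 := by
    refine Finset.sum_eq_zero fun c₁ _ ↦ ?_
    rw [← Finset.sum_mul]
    have : ∑ d₀ : ZMod (u * v), tcWeight ψ φ c₁ d₀ = 0 := by
      simp only [tcWeight, ← Finset.mul_sum, sum_inv_castHom_eq_zero φ hφ1, mul_zero]
    rw [this, zero_mul]
  have h1 : twoCharOne ψ φ τ = ∑ c₁ : ZMod u, ∑' m : ℤ, ∑ d₀ : ZMod (u * v),
      tcWeight ψ φ c₁ d₀ * zetaRow (u * v) (tcLift c₁ d₀) τ m := by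
    change ∑ c₁ : ZMod u, ∑ d₀ : ZMod (u * v),
      tcWeight ψ φ c₁ d₀ * eisensteinOneDivZ (u * v) (tcVec c₁ d₀) τ = _
    simp_rw [hZ, mul_add, Finset.sum_add_distrib]
    rw [hconst, zero_add]
    refine Finset.sum_congr rfl fun c₁ _ ↦ ?_
    simp_rw [← tsum_mul_left]
    rw [Summable.tsum_finsetSum fun d₀ _ ↦ hT c₁ d₀]
  rw [h1]
  simp_rw [sum_tcWeight_mul_zetaRow ψ φ τ hψ1 hφ1]
  have hF' : ∀ c₁ : ZMod u, ∑' m : ℤ, ψ c₁ * oneRow u φ ((c₁.val : ℤ) - u * m) τ =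
      ∑' j : ℤ, ψ (((j * u + (c₁.val : ℤ) : ℤ)) : ZMod u) * oneRow u φ (j * u + (c₁.val : ℤ)) τ := by
    intro c₁
    rw [← (Equiv.neg ℤ).tsum_eq]
    refine tsum_congr fun j ↦ ?_
    simp only [Equiv.neg_apply]
    rw [intCast_mul_add_val]
    have : ((c₁.val : ℤ) - u * -j) = j * u + (c₁.val : ℤ) := by ring
    rw [this]
  simp_rw [hF']
  exact (tsum_int_eq_sum_zmod_tsum u hF).symm

end Regroup

/-! ### The `q`-expansion -/

section QExpansion

/-- The constant `2 · (-2πi) · u · τ(φ̄)` in front of `∑ σ_0^{ψ,φ}(n) qⁿ`.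
[cite: DiamondShurman2005, Thm. 4.8.1] -/
def twoCharOneConst (u : ℕ) {v : ℕ} [NeZero v] (φ : DirichletCharacter ℂ v) : ℂ :=
  2 * (-(2 * π * I) * u * gaussSum φ⁻¹ (ZMod.stdAddChar (N := v)))

variable {u v : ℕ} [NeZero u] [NeZero v] (ψ : DirichletCharacter ℂ u) (φ : DirichletCharacter ℂ v)

/-- **The weighted rows sum to the divisor series**:
`∑_{c ∈ ℤ} ψ(c) R_c = C ∑_{n ≥ 1} σ_0^{ψ,φ}(n) qⁿ` as a `HasSum` over `ℤ` (rows `c ≥ 1` and `c ≤ -1`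
contribute equally since `ψ(-1)φ(-1) = -1`; the row `c = 0` is weighted by `ψ(0) = 0`).
[cite: DiamondShurman2005, §4.8 (Thm. 4.8.1)] -/
theorem hasSum_weightedOneRow (hψ1 : ψ ≠ 1) (hφ : φ.IsPrimitive) (hφ1 : φ ≠ 1)
    (hpar : ψ (-1) * φ (-1) = -1) (τ : ℍ) :
    HasSum (fun c : ℤ ↦ ψ c * oneRow u φ c τ)
      (twoCharOneConst u φ * ∑' n : ℕ+, (∑ d ∈ (n : ℕ).divisors, ψ (((n : ℕ) / d : ℕ)) * φ d) *
        cexp (2 * π * I * τ) ^ (n : ℕ)) := by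
  have hq : ‖cexp (2 * π * I * τ)‖ < 1 := norm_exp_two_pi_I_lt_one τ
  -- the double family on `ℕ+ × ℕ+`
  set G : ℕ+ × ℕ+ → ℂ := fun p ↦ ψ (p.1 : ℕ) * φ (p.2 : ℕ) * ((p.2 : ℕ) : ℂ) ^ 0 *
    cexp (2 * π * I * τ) ^ ((p.1 : ℕ) * (p.2 : ℕ)) with hG
  have hGs : Summable G := summable_prod_weight₂_mul_pow 0 hq (fun d ↦ ψ d) (fun d ↦ φ d)
    (fun d ↦ ψ.norm_le_one _) (fun d ↦ φ.norm_le_one _)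
  have hGsum : ∑' p, G p =
      ∑' n : ℕ+, (∑ d ∈ (n : ℕ).divisors, ψ (((n : ℕ) / d : ℕ)) * φ d) *
        cexp (2 * π * I * τ) ^ (n : ℕ) := by
    simp only [hG]
    rw [tsum_prod_weight₂_mul_pow_eq_tsum_divisorSum 0 hq (fun d ↦ ψ d) (fun d ↦ φ d)
      (fun d ↦ ψ.norm_le_one _) (fun d ↦ φ.norm_le_one _)]
    simp only [pow_zero, mul_one]
  have hE : ∀ c n : ℕ, cexp (2 * π * I * τ) ^ (c * n) = cexp (2 * π * I * c * τ) ^ n := by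
    intro c n
    rw [pow_mul, ← Complex.exp_nat_mul]
    congr 1
    congr 1
    ring
  obtain ⟨K, hK⟩ : ∃ K : ℂ, K = -(2 * π * I) * u * gaussSum φ⁻¹ (ZMod.stdAddChar (N := v)) :=
    ⟨_, rfl⟩
  -- rows `c ≥ 1`
  have hrowpos : ∀ c : ℕ+, HasSum (fun n : ℕ+ ↦ K * G (c, n))
      (ψ ((c : ℕ) : ℤ) * oneRow u φ ((c : ℕ) : ℤ) τ) := by
    intro c
    have h := (hasSum_oneRow_of_pos φ u hφ hφ1 c.pos τ).mul_left (ψ ((c : ℕ) : ℤ))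
    have h0 : ∀ n : ℕ, n ∉ Set.range ((↑) : ℕ+ → ℕ) →
        ψ ((c : ℕ) : ℤ) * ((-(2 * π * I) * u * gaussSum φ⁻¹ (ZMod.stdAddChar (N := v))) * φ n *
          cexp (2 * π * I * (c : ℕ) * τ) ^ n) = 0 := by
      intro n hn
      have : n = 0 := by
        by_contra h'
        exact hn ⟨⟨n, Nat.pos_of_ne_zero h'⟩, rfl⟩
      subst this
      simp [apply_zero_eq_zero_of_ne_one φ hφ1]
    have h2 := (Function.Injective.hasSum_iff PNat.coe_injective h0).mpr h
    refine h2.congr_fun fun n ↦ ?_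
    simp only [Function.comp_apply, hG, hK, pow_zero, mul_one, Int.cast_natCast, hE]
    ring
  -- rows `c ≤ -1`
  have hrowneg : ∀ c : ℕ+, HasSum (fun n : ℕ+ ↦ K * G (c, n))
      (ψ (-((c : ℕ) : ℤ)) * oneRow u φ (-((c : ℕ) : ℤ)) τ) := by
    intro c
    have h := (hasSum_oneRow_neg_of_pos φ u hφ hφ1 c.pos τ).mul_left (ψ (-((c : ℕ) : ℤ)))
    have h0 : ∀ n : ℕ, n ∉ Set.range ((↑) : ℕ+ → ℕ) →
        ψ (-((c : ℕ) : ℤ)) * (((2 * π * I) * u * gaussSum φ⁻¹ (ZMod.stdAddChar (N := v)) * φ (-1)) *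
          φ n * cexp (2 * π * I * (c : ℕ) * τ) ^ n) = 0 := by
      intro n hn
      have : n = 0 := by
        by_contra h'
        exact hn ⟨⟨n, Nat.pos_of_ne_zero h'⟩, rfl⟩
      subst this
      simp [apply_zero_eq_zero_of_ne_one φ hφ1]
    have h2 := (Function.Injective.hasSum_iff PNat.coe_injective h0).mpr h
    refine h2.congr_fun fun n ↦ ?_
    simp only [Function.comp_apply, hG, hK, pow_zero, mul_one, Int.cast_natCast, hE]
    have hψn : ψ (-((c : ℕ) : ZMod u)) = ψ (-1) * ψ (c : ℕ) := by
      rw [neg_eq_neg_one_mul, map_mul]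
    rw [hψn]
    linear_combination (-(2 * π * I) * u * gaussSum φ⁻¹ (ZMod.stdAddChar (N := v)) *
      ψ (c : ℕ) * φ (n : ℕ) * cexp (2 * π * I * (c : ℕ) * τ) ^ (n : ℕ)) * hpar
  -- fibrewise summation of `K G`
  have hGK : HasSum (fun p : ℕ+ × ℕ+ ↦ K * G p) (K * ∑' p, G p) := hGs.hasSum.mul_left K
  have hposP : HasSum (fun c : ℕ+ ↦ ψ ((c : ℕ) : ℤ) * oneRow u φ ((c : ℕ) : ℤ) τ)
      (K * ∑' p, G p) := hGK.prod_fiberwise hrowpos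
  have hnegP : HasSum (fun c : ℕ+ ↦ ψ (-((c : ℕ) : ℤ)) * oneRow u φ (-((c : ℕ) : ℤ)) τ)
      (K * ∑' p, G p) := hGK.prod_fiberwise hrowneg
  -- to `ℕ`-indexed families and to `ℤ`
  have hpos : HasSum (fun c : ℕ ↦ ψ (c : ℤ) * oneRow u φ (c : ℤ) τ) (K * ∑' p, G p) := by
    have h0 : ∀ c : ℕ, c ∉ Set.range ((↑) : ℕ+ → ℕ) → ψ (c : ℤ) * oneRow u φ (c : ℤ) τ = 0 := by
      intro c hc
      have : c = 0 := by
        by_contra h'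
        exact hc ⟨⟨c, Nat.pos_of_ne_zero h'⟩, rfl⟩
      subst this
      simp [apply_zero_eq_zero_of_ne_one ψ hψ1]
    exact (Function.Injective.hasSum_iff PNat.coe_injective h0).mp hposP
  have hneg : HasSum (fun n : ℕ ↦ ψ ((-((n : ℤ) + 1) : ℤ)) * oneRow u φ (-((n : ℤ) + 1)) τ)
      (K * ∑' p, G p) := by
    have h := (Equiv.hasSum_iff Equiv.pnatEquivNat.symm).mpr hnegP
    refine h.congr_fun fun n ↦ ?_
    simp only [Function.comp_apply, Equiv.pnatEquivNat_symm_apply, Nat.succPNat_coe, Nat.cast_succ,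
      Int.cast_neg, Int.cast_add, Int.cast_one, Int.cast_natCast]
  have hall := HasSum.of_nat_of_neg_add_one (f := fun c : ℤ ↦ ψ c * oneRow u φ c τ) hpos hneg
  rw [hGsum] at hall
  convert hall using 1
  rw [twoCharOneConst, ← hK]
  ring

/-- **The `q`-expansion of `S_1^{ψ,φ}`** (`ψ ≠ 𝟙`, `φ ≠ 𝟙` primitive, `ψ(-1)φ(-1) = -1`):
`S(τ) = 2 (-2πi) u τ(φ̄) ∑_{n ≥ 1} σ_0^{ψ,φ}(n) qⁿ`, `σ_0^{ψ,φ}(n) = ∑_{d ∣ n} ψ(n/d) φ(d)`; in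
particular the constant term at `i∞` vanishes. [cite: DiamondShurman2005, Thm. 4.8.1] -/
theorem twoCharOne_eq_qExpansion (hψ1 : ψ ≠ 1) (hφ : φ.IsPrimitive) (hφ1 : φ ≠ 1)
    (hpar : ψ (-1) * φ (-1) = -1) (τ : ℍ) :
    twoCharOne ψ φ τ = twoCharOneConst u φ *
      ∑' n : ℕ+, (∑ d ∈ (n : ℕ).divisors, ψ (((n : ℕ) / d : ℕ)) * φ d) *
        cexp (2 * π * I * τ) ^ (n : ℕ) := by
  have h := hasSum_weightedOneRow ψ φ hψ1 hφ hφ1 hpar τ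
  rw [twoCharOne_eq_tsum_rows ψ φ τ hψ1 hφ1 h.summable, h.tsum_eq]

/-- **The `q`-expansion coefficients of the modular form `S_1^{ψ,φ} ∈ M_1(Γ₁(uv))`**:
`a₀ = 0` and `aₙ = twoCharOneConst · σ_0^{ψ,φ}(n)` for `n ≥ 1`.
[cite: DiamondShurman2005, Thm. 4.8.1] -/
theorem qExpansion_coeff_twoCharOneMF (hψ1 : ψ ≠ 1) (hφ : φ.IsPrimitive) (hφ1 : φ ≠ 1)
    (hpar : ψ (-1) * φ (-1) = -1) (n : ℕ) :
    (qExpansion 1 ⇑(twoCharOneMF ψ φ)).coeff n =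
      if n = 0 then 0 else twoCharOneConst u φ * ∑ d ∈ n.divisors, ψ ((n / d : ℕ)) * φ d := by
  set β : ℂ := twoCharOneConst u φ with hβ
  set c : ℕ → ℂ := fun m ↦ if m = 0 then 0 else
    β * ∑ d ∈ m.divisors, ψ ((m / d : ℕ)) * φ d with hc
  suffices h : ∀ τ : ℍ, HasSum (fun m ↦ c m • Function.Periodic.qParam (1 : ℝ) τ ^ m)
      (twoCharOneMF ψ φ τ) from
    (ModularFormClass.qExpansion_coeff_unique one_pos (by simp) h n).symm
  intro τ
  change HasSum (fun m ↦ c m * Function.Periodic.qParam (1 : ℝ) τ ^ m) (twoCharOneMF ψ φ τ)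
  have hq : ‖cexp (2 * π * I * τ)‖ < 1 := norm_exp_two_pi_I_lt_one τ
  have hS : Summable fun m : ℕ ↦ (∑ d ∈ (m + 1).divisors, ψ (((m + 1) / d : ℕ)) * φ d * (d : ℂ) ^ 0) *
      cexp (2 * π * I * τ) ^ (m + 1) :=
    (summable_nat_add_iff 1).mpr
      (summable_divisorSum₂_mul_pow 0 hq (fun d ↦ ψ d) (fun d ↦ φ d)
        (fun d ↦ ψ.norm_le_one _) fun d ↦ φ.norm_le_one _)
  simp only [pow_zero, mul_one] at hS
  rw [← hasSum_nat_add_iff' 1]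
  simp only [Nat.add_eq_zero_iff, one_ne_zero, and_false, ↓reduceIte, Finset.range_one,
    Finset.sum_singleton, c, Function.Periodic.qParam, Complex.ofReal_one, div_one,
    zero_mul, sub_zero]
  have hval : twoCharOneMF ψ φ τ =
      β * ∑' m : ℕ, (∑ d ∈ (m + 1).divisors, ψ (((m + 1) / d : ℕ)) * φ d) *
        cexp (2 * π * I * τ) ^ (m + 1) := by
    change twoCharOne ψ φ τ = _
    rw [twoCharOne_eq_qExpansion ψ φ hψ1 hφ hφ1 hpar τ, ← hβ,
      tsum_pnat_eq_tsum_succ (f := fun m : ℕ ↦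
        (∑ d ∈ m.divisors, ψ ((m / d : ℕ)) * φ d) * cexp (2 * π * I * τ) ^ m)]
  rw [hval]
  have h := hS.hasSum.mul_left β
  simp only [← mul_assoc] at h
  exact h

end QExpansion

end Literature.NumberTheory.EllipticCurves.ModularForms
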